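import Literature.NumberTheory.Transcendental.ThetaSubgroupClassification
import Literature.NumberTheory.Transcendental.ThetaMorphic
import Literature.NumberTheory.Transcendental.PkappaThetaChartIdentities
import HarnessLib

/-!
# Split algebraic subgroups of `M_κ` are cut out by theta forms

Topic: `Literature/NumberTheory/Transcendental`. A brick of the discharge of the named fact
`Literature.NumberTheory.Transcendental.philippon1986_std` (classification of the obstruction
subgroups of Philippon's zero estimate on `M_κ = 𝔾ₘ^β × P_κ`, general number of elliptic factors,
no complex multiplication). For a connected algebraic subgroup datum `K = (A, C, Ξ)`
(`GaGmE.Std.SubgroupDataC`) whose abelian part is SPLIT — `C = span_ℚ {e_b : b ∈ S}` for a set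
`S` of `E`-coordinates — the preimage `exp⁻¹(G') = Lie G' + ker(exp)`
(`GaGmE.Std.preimageSubgroup`) is the common zero set of the explicit forms (`splitForms`)

* the binomial forms of the integer characters `q ∈ A` (`binomForm`, torus conditions
  `e^{⟨q,y'⟩} = 1`),
* the pure coordinates `X_{(∅,(M,∅))}` with `M b = 0` for some `b ∈ S` (`= σ(z'_b)³ · …`, the
  conditions `z'_b ∈ Λ`, `b ∈ S`),
* the linear forms `∑_e ξ_e X_{(∅,(M,e))}`, `ξ ∈ Ξ`, `M ≡ 2` on `S` (the fibre conditions
  `⟨ξ, s - κ η(λ)⟩ = 0`: `Z₂(0) = 0`, `P₂(0) = -2`, and the compatibility `ξ ∘ κ ∈ span C` kills the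
  companions of the blocks outside `S`),

generalising `ThetaSubgroupClassification.mem_preimageSubgroup_hull_of_forall_thetaEval` (the case
`S = ∅` or `S = γ`, `|γ| ≤ 1`) — `GaGmE.Std.coe_preimageSubgroup_eq_zeroLocus_of_split`; in
particular such a preimage is `Θ`-definable (`thetaDefinable_preimageSubgroup_of_split`, in the
sense of `ThetaMorphic.lean`), and the closure `Z(𝔍(Lie G'))` of the Lie algebra in any theta model
is contained in it. The general abelian datum is reduced to this case by integer changes of the
`E`-coordinates in the sequel. Also: for ANY set of forms vanishing on `Lie G'`, the whole preimage
lies in their zero locus (`preimageSubgroup_subset_zeroLocus`, automorphy under `ker`).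

Everything is PROVED; the only definitions are the coordinate spans and the set of forms.

## References

* Yu. V. Nesterenko, P. Philippon (eds.), *Introduction to Algebraic Independence Theory*,
  LNM 1752, Springer 2001, Ch. 11 (D. Roy), Thm. 4.1. [NesterenkoPhilippon2001]
* D. Bertrand, P. Philippon, *Sous-groupes algébriques de groupes algébriques commutatifs*,
  Illinois J. Math. 32 (1988), 263–280. [folklore]
-/

noncomputable section

open Complex MvPolynomial
open scoped PeriodPair

namespace Literature.NumberTheory.Transcendental

namespace GaGmE

namespace Std

variable {β γ δ : Type} [Fintype β] [Fintype γ] [Fintype δ] [DecidableEq γ]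
variable (L : PeriodPair) (κM : δ → γ → Kbar)

/-! ### Coordinate spans -/

/-- The coordinate subspace `span_ℚ {e_b : b ∈ S} ≤ ℚ^γ`. [folklore] -/
def coordSpan (S : Finset γ) : Submodule ℚ (γ → ℚ) :=
  Submodule.span ℚ ((fun b => Pi.single b (1 : ℚ)) '' (S : Set γ))

omit [Fintype γ] in
/-- `e_b ∈ coordSpan S` for `b ∈ S`. [folklore] -/
theorem single_mem_coordSpan {S : Finset γ} {b : γ} (hb : b ∈ S) : Pi.single b (1 : ℚ) ∈ coordSpan S :=
  Submodule.subset_span ⟨b, hb, rfl⟩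

omit [Fintype γ] in
/-- Vectors of `coordSpan S` vanish outside `S`. [folklore] -/
theorem apply_eq_zero_of_mem_coordSpan {S : Finset γ} {c : γ → ℚ} (hc : c ∈ coordSpan S) {b : γ}
    (hb : b ∉ S) : c b = 0 := by
  let T : Submodule ℚ (γ → ℚ) :=
    { carrier := {c | c b = 0}
      zero_mem' := by simp
      add_mem' := by intro x y hx hy; simp_all
      smul_mem' := by intro a x hx; simp_all }
  have hle : coordSpan S ≤ T := by
    refine Submodule.span_le.mpr ?_
    rintro _ ⟨b', hb', rfl⟩
    show (Pi.single b' (1 : ℚ) : γ → ℚ) b = 0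
    rw [Pi.single_apply, if_neg]
    rintro rfl
    exact hb hb'
  exact hle hc

omit [Fintype γ] in
/-- Complex combinations of vectors of `coordSpan S` vanish outside `S`. [folklore] -/
theorem apply_eq_zero_of_mem_span_coordSpan {S : Finset γ} {v : γ → ℂ}
    (hv : v ∈ Submodule.span ℂ ((fun c : γ → ℚ => fun b => (c b : ℂ)) '' (coordSpan S : Set (γ → ℚ))))
    {b : γ} (hb : b ∉ S) : v b = 0 := by
  let T : Submodule ℂ (γ → ℂ) :=
    { carrier := {v | v b = 0}
      zero_mem' := by simp
      add_mem' := by intro x y hx hy; simp_all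
      smul_mem' := by intro a x hx; simp_all }
  have hle : Submodule.span ℂ ((fun c : γ → ℚ => fun b => (c b : ℂ)) '' (coordSpan S : Set (γ → ℚ))) ≤ T := by
    refine Submodule.span_le.mpr ?_
    rintro _ ⟨c, hc, rfl⟩
    show ((c b : ℚ) : ℂ) = 0
    rw [apply_eq_zero_of_mem_coordSpan hc hb, Rat.cast_zero]
  exact hle hv

/-! ### The zero locus of forms vanishing on `Lie G'` contains the whole preimage -/

/-- **Automorphy**: the zero locus of a set of forms is a union of `ker(exp)`-orbits, so it contains
`Lie G' + ker` as soon as it contains `Lie G'`. [folklore] -/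
theorem preimageSubgroup_subset_zeroLocus {Ps : Set (MvPolynomial (Option β × ThetaIdx γ δ) ℂ)}
    (hPs : ∀ P ∈ Ps, ∃ d, P.IsHomogeneous d) (K : SubgroupDataC β γ δ κM)
    (hvan : ∀ P ∈ Ps, ∀ t ∈ K.tangent, thetaEval L κM P t = 0) :
    (preimageSubgroup L κM K : Set (β ⊕ (γ ⊕ δ) → ℂ)) ⊆ {w | ∀ P ∈ Ps, thetaEval L κM P w = 0} := by
  intro w hw
  obtain ⟨t, ht, k, hk, rfl⟩ := AddSubgroup.mem_sup.mp hw
  -- the zero locus is invariant under the group generated by `ker`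
  have key : ∀ k ∈ AddSubgroup.closure (ker L κM), ∀ x : β ⊕ (γ ⊕ δ) → ℂ,
      (∀ P ∈ Ps, thetaEval L κM P (x + k) = 0) ↔ (∀ P ∈ Ps, thetaEval L κM P x = 0) := by
    intro k hk
    induction hk using AddSubgroup.closure_induction with
    | mem k hk =>
      intro x
      refine forall₂_congr fun P hP => ?_
      obtain ⟨d, hd⟩ := hPs P hP
      exact thetaEval_add_ker_eq_zero_iff L κM hd hk x
    | zero => intro x; simp
    | add k₁ k₂ _ _ h₁ h₂ =>
      intro x
      rw [← add_assoc, h₂ (x + k₁), h₁ x]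
    | neg k _ h =>
      intro x
      have := h (x + -k)
      rw [neg_add_cancel_right] at this
      exact this.symm
  exact (key k hk t).mpr fun P hP => hvan P hP t ht

/-! ### The forms of a split datum -/

/-- **The forms cutting out a split algebraic subgroup** (module docstring). [folklore] -/
def splitForms (K : SubgroupDataC β γ δ κM) (S : Finset γ) : Set (MvPolynomial (Option β × ThetaIdx γ δ) ℂ) :=
  {P | ∃ (q : β → ℤ) (M : γ → Fin 3), q ∈ intRel K.A ∧ P = binomForm q (M, none)} ∪
    {P | ∃ M : γ → Fin 3, (∃ b ∈ S, M b = 0) ∧ P = X (none, (M, none))} ∪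
    {P | ∃ (ξ : δ → ℂ) (M : γ → Fin 3), ξ ∈ K.Ξ ∧ (∀ b ∈ S, M b = 2) ∧ P = linForm ξ M}

omit [DecidableEq γ] in
/-- The split forms are forms. [folklore] -/
theorem exists_isHomogeneous_of_mem_splitForms {K : SubgroupDataC β γ δ κM} {S : Finset γ}
    {P : MvPolynomial (Option β × ThetaIdx γ δ) ℂ} (hP : P ∈ splitForms κM K S) : ∃ d, P.IsHomogeneous d := by
  rcases hP with (⟨q, M, -, rfl⟩ | ⟨M, -, rfl⟩) | ⟨ξ, M, -, -, rfl⟩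
  · exact ⟨_, isHomogeneous_binomForm q (M, none)⟩
  · exact ⟨1, isHomogeneous_X ℂ _⟩
  · exact ⟨1, isHomogeneous_linForm ξ M⟩

/-- **The split forms vanish on `Lie G'`.** [folklore] -/
theorem thetaEval_eq_zero_of_mem_splitForms {K : SubgroupDataC β γ δ κM} {S : Finset γ}
    (hC : K.C = coordSpan S) {P : MvPolynomial (Option β × ThetaIdx γ δ) ℂ} (hP : P ∈ splitForms κM K S)
    {t : β ⊕ (γ ⊕ δ) → ℂ} (ht : t ∈ K.tangent) : thetaEval L κM P t = 0 := by
  obtain ⟨hA, hCt, hΞ⟩ := (K.mem_tangent_iff t).mp ht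
  have hsum : ∀ b, ∑ x, (((Pi.single b (1 : ℚ) : γ → ℚ) x : ℚ) : ℂ) * t (iz x) = t (iz b) := by
    intro b
    rw [Finset.sum_eq_single b (fun x _ hx => by simp [hx]) (fun h => absurd (Finset.mem_univ b) h)]
    simp
  have hzS : ∀ b ∈ S, t (iz b) = 0 := by
    intro b hb
    have h := hCt _ (hC ▸ single_mem_coordSpan hb)
    rwa [hsum] at h
  rcases hP with (⟨q, M, hq, rfl⟩ | ⟨M, ⟨b, hb, hMb⟩, rfl⟩) | ⟨ξ, M, hξ, hM2, rfl⟩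
  · -- binomial: `⟨q, y'(t)⟩ = 0`
    have h0 : ∑ j, (q j : ℂ) * t (iy j) = 0 := by
      have := hA _ (mem_intRel_iff.mp hq)
      simpa using this
    rw [thetaEval_binomForm, h0, exp_zero, sub_self, mul_zero]
  · -- pure coordinate with `M b = 0`, `b ∈ S`: `σ(0)³ = 0`
    rw [thetaEval_X, theta, thetaT_none, one_mul, thetaP_none]
    refine Finset.prod_eq_zero (Finset.mem_univ b) ?_
    rw [hMb, hzS b hb]
    exact L.univExtP_at_zero.1
  · -- linear form
    rw [thetaEval_linForm]
    have hs : ∑ e, ξ e * t (is e) = 0 := hΞ ξ hξ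
    rw [hs, zero_mul, zero_sub, neg_eq_zero]
    refine Finset.sum_eq_zero fun b _ => ?_
    by_cases hb : b ∈ S
    · rw [hM2 b hb, hzS b hb, L.univExtZ_at_zero.2.2]; ring
    · have hκ : (∑ e, ξ e * (κM e b : ℂ)) = 0 := by
        have := K.compat ξ hξ
        rw [hC] at this
        exact apply_eq_zero_of_mem_span_coordSpan this hb
      rw [hκ, zero_mul]

/-! ### The zero locus of the split forms is the preimage -/

/-- **A common zero of the split forms lies in `Lie G' + ker`.** [folklore] -/
theorem mem_preimageSubgroup_of_forall_splitForms {K : SubgroupDataC β γ δ κM} {S : Finset γ}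
    (hC : K.C = coordSpan S) {w : β ⊕ (γ ⊕ δ) → ℂ}
    (hw : ∀ P ∈ splitForms κM K S, thetaEval L κM P w = 0) : w ∈ preimageSubgroup L κM K := by
  classical
  obtain ⟨Mc, hMc⟩ := exists_thetaPnone_ne_zero (β := β) (δ := δ) L w
  have hMcb : ∀ b, L.univExtP (Mc b) (w (iz b)) ≠ 0 := fun b =>
    (Finset.prod_ne_zero_iff.mp hMc) b (Finset.mem_univ b)
  -- (Y) torus: the integer characters of `A` are trivial at `y'(w)`
  have hY : ∀ q : β → ℤ, (fun j => (q j : ℚ)) ∈ K.A → cexp (∑ j, (q j : ℂ) * w (iy j)) = 1 := by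
    intro q hq
    by_contra hne
    have := hw _ (Or.inl (Or.inl ⟨q, Mc, mem_intRel_iff.mpr hq, rfl⟩))
    rw [thetaEval_binomForm, thetaP_none] at this
    rcases mul_eq_zero.mp this with h | h
    · rcases mul_eq_zero.mp h with h | h
      · exact hMc (pow_eq_zero_iff'.mp h).1
      · exact exp_ne_zero _ h
    · exact hne (sub_eq_zero.mp h)
  obtain ⟨mm, hmm⟩ := exists_int_shift_of_forall_exp_eq_one K.A (fun j => w (iy j)) hY
  -- (E) the `E`-coordinates in `S` are lattice points
  have hzΛ : ∀ b ∈ S, w (iz b) ∈ L.lattice := by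
    intro b hb
    have := hw _ (Or.inl (Or.inr ⟨Function.update Mc b 0, ⟨b, hb, Function.update_self _ _ _⟩, rfl⟩))
    rw [thetaEval_X, theta, thetaT_none, one_mul, thetaP_none, thetaPnone_update] at this
    rcases mul_eq_zero.mp this with h | h
    · exact (univExtP_zero_eq_zero_iff L _).mp h
    · obtain ⟨b', hb', h0⟩ := Finset.prod_eq_zero_iff.mp h
      exact absurd h0 (hMcb b')
  have hmn' : ∀ b, ∃ m n : ℤ, b ∈ S → (m : ℂ) * L.ω₁ + n * L.ω₂ = w (iz b) := by
    intro b
    by_cases hb : b ∈ S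
    · obtain ⟨m, n, h⟩ := PeriodPair.mem_lattice.mp (hzΛ b hb)
      exact ⟨m, n, fun _ => h⟩
    · exact ⟨0, 0, fun h => absurd h hb⟩
  choose m₀ n₀ hmn₀ using hmn'
  let m : γ → ℤ := fun b => if b ∈ S then m₀ b else 0
  let n : γ → ℤ := fun b => if b ∈ S then n₀ b else 0
  have hmnS : ∀ b ∈ S, (m b : ℂ) * L.ω₁ + (n b : ℂ) * L.ω₂ = w (iz b) := by
    intro b hb; simp only [m, n, if_pos hb]; exact hmn₀ b hb
  have hmn0 : ∀ b, b ∉ S → (m b : ℂ) * L.ω₁ + (n b : ℂ) * L.ω₂ = 0 := by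
    intro b hb; simp [m, n, if_neg hb]
  set k₀ : β ⊕ (γ ⊕ δ) → ℂ := coords (0 : β → ℂ) (fun b => (m b : ℂ) * L.ω₁ + (n b : ℂ) * L.ω₂)
    (fun e => ∑ b, (κM e b : ℂ) * ((m b : ℂ) * L.η₁ + (n b : ℂ) * L.η₂)) with hk₀
  have hk₀mem : k₀ ∈ ker L κM := coords_lattice_mem_ker L κM m n
  set x : β ⊕ (γ ⊕ δ) → ℂ := w - k₀ with hx
  have hwx : w = x + k₀ := by rw [hx, sub_add_cancel]
  have hxzS : ∀ b ∈ S, x (iz b) = 0 := by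
    intro b hb; simp [hx, hk₀, hmnS b hb]
  have hxz : ∀ b, b ∉ S → x (iz b) = w (iz b) := by
    intro b hb; simp [hx, hk₀, hmn0 b hb]
  -- (S) the fibre conditions at `x`
  set Mc' : γ → Fin 3 := fun b => if b ∈ S then 2 else Mc b with hMc'
  have hPx : thetaPnone (β := β) (δ := δ) L Mc' x ≠ 0 := by
    refine Finset.prod_ne_zero_iff.mpr fun b _ => ?_
    by_cases hb : b ∈ S
    · simp only [hMc', if_pos hb, hxzS b hb, L.univExtP_at_zero.2.2]; norm_num
    · simp only [hMc', if_neg hb, hxz b hb]; exact hMcb b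
  have hΞ : ∀ ξ ∈ K.Ξ, ∑ e, ξ e * x (is e) = 0 := by
    intro ξ hξ
    have h1 := hw _ (Or.inr ⟨ξ, Mc', hξ, fun b hb => by simp [hMc', hb], rfl⟩)
    rw [hwx, thetaEval_add_ker_eq_zero_iff L κM (isHomogeneous_linForm ξ _) hk₀mem, thetaEval_linForm] at h1
    have hsum : ∑ b, (∑ e, ξ e * (κM e b : ℂ)) * (L.univExtZ (Mc' b) (x (iz b)) *
        ∏ b' ∈ Finset.univ.erase b, L.univExtP (Mc' b') (x (iz b'))) = 0 := by
      refine Finset.sum_eq_zero fun b _ => ?_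
      by_cases hb : b ∈ S
      · have : Mc' b = 2 := by simp [hMc', hb]
        rw [this, hxzS b hb, L.univExtZ_at_zero.2.2]; ring
      · have hκ : (∑ e, ξ e * (κM e b : ℂ)) = 0 := by
          have := K.compat ξ hξ
          rw [hC] at this
          exact apply_eq_zero_of_mem_span_coordSpan this hb
        rw [hκ, zero_mul]
    rw [hsum, sub_zero] at h1
    exact (mul_eq_zero.mp h1).resolve_right hPx
  -- assemble: `w = t + (2πi mm; 0; 0) + k₀` with `t ∈ Lie G'`
  set y₁ : β → ℂ := fun j => w (iy j) - 2 * Real.pi * I * (mm j) with hy₁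
  set t : β ⊕ (γ ⊕ δ) → ℂ := coords y₁ (zPart x) (sPart x) with ht
  have htmem : t ∈ K.tangent := by
    rw [K.mem_tangent_iff]
    refine ⟨fun q hq => by simpa [ht] using hmm q hq, fun c hc => ?_, fun ξ hξ => by simpa [ht, sPart] using hΞ ξ hξ⟩
    simp only [ht, coords_iz, zPart]
    refine Finset.sum_eq_zero fun b _ => ?_
    by_cases hb : b ∈ S
    · rw [hxzS b hb, mul_zero]
    · rw [hC] at hc
      rw [apply_eq_zero_of_mem_coordSpan hc hb, Rat.cast_zero, zero_mul]
  have hkT : coords (fun j => 2 * Real.pi * I * (mm j : ℂ)) (0 : γ → ℂ) (0 : δ → ℂ) ∈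
      AddSubgroup.closure (ker L κM) := AddSubgroup.subset_closure (coords_two_pi_I_mem_ker L κM mm)
  have hxt : x = t + coords (fun j => 2 * Real.pi * I * (mm j : ℂ)) (0 : γ → ℂ) (0 : δ → ℂ) := by
    funext i
    rcases i with j | b | e
    · show x (iy j) = t (iy j) + coords (fun j => 2 * Real.pi * I * (mm j : ℂ)) (0 : γ → ℂ) (0 : δ → ℂ) (iy j)
      simp only [hx, ht, hk₀, hy₁, Pi.sub_apply, coords_iy, Pi.zero_apply]
      ring
    · show x (iz b) = t (iz b) + coords (fun j => 2 * Real.pi * I * (mm j : ℂ)) (0 : γ → ℂ) (0 : δ → ℂ) (iz b)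
      simp only [ht, coords_iz, zPart, Pi.zero_apply, add_zero]
    · show x (is e) = t (is e) + coords (fun j => 2 * Real.pi * I * (mm j : ℂ)) (0 : γ → ℂ) (0 : δ → ℂ) (is e)
      simp only [ht, coords_is, sPart, Pi.zero_apply, add_zero]
  rw [hwx, hxt, add_assoc]
  exact AddSubgroup.add_mem _ (AddSubgroup.mem_sup_left htmem)
    (AddSubgroup.mem_sup_right (AddSubgroup.add_mem _ hkT (AddSubgroup.subset_closure hk₀mem)))

/-- **The preimage `exp⁻¹(G')` of a split algebraic subgroup is the common zero set of the split
forms.** [folklore] -/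
theorem coe_preimageSubgroup_eq_zeroLocus_of_split (K : SubgroupDataC β γ δ κM) (S : Finset γ)
    (hC : K.C = coordSpan S) :
    (preimageSubgroup L κM K : Set (β ⊕ (γ ⊕ δ) → ℂ)) = {w | ∀ P ∈ splitForms κM K S, thetaEval L κM P w = 0} :=
  Set.Subset.antisymm
    (preimageSubgroup_subset_zeroLocus L κM (fun _ hP => exists_isHomogeneous_of_mem_splitForms κM hP) K
      fun _ hP _ ht => thetaEval_eq_zero_of_mem_splitForms L κM hC hP ht)
    fun _ hw => mem_preimageSubgroup_of_forall_splitForms L κM hC hw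

/-- **The preimage of a split algebraic subgroup is `Θ`-definable.** [folklore] -/
theorem thetaDefinable_preimageSubgroup_of_split (K : SubgroupDataC β γ δ κM) (S : Finset γ)
    (hC : K.C = coordSpan S) :
    ThetaDefinable L κM (preimageSubgroup L κM K : Set (β ⊕ (γ ⊕ δ) → ℂ)) :=
  ⟨splitForms κM K S, fun _ hP => exists_isHomogeneous_of_mem_splitForms κM hP,
    coe_preimageSubgroup_eq_zeroLocus_of_split L κM K S hC⟩

/-! ### Consequence in a theta model: the closure of `Lie G'` -/

section Model

variable {N : ℕ} (M : AnalyticGroupModel (β ⊕ (γ ⊕ δ) → ℂ) N) (e : Option β × ThetaIdx γ δ ≃ Fin (N + 1))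
variable (hΘ : ∀ J w, M.Θ (e J) w = theta L κM J w)
include hΘ

/-- **If `exp⁻¹(G')` is `Θ`-definable, the closure `Z(𝔍(Lie G'))` of the Lie algebra lies in
`exp⁻¹(G')`** (indeed in any definable set containing `Lie G'`). [folklore] -/
theorem zeroSet_vanishing_subset_of_thetaDefinable {X Y : Set (β ⊕ (γ ⊕ δ) → ℂ)}
    (hX : ThetaDefinable L κM X) (hYX : Y ⊆ X) :
    M.zeroSet ((M.vanishing Y : Ideal _) : Set (MvPolynomial (Fin (N + 1)) ℂ)) ⊆ X := by
  obtain ⟨Ps, hPs, rfl⟩ := hX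
  intro w hw P hP
  obtain ⟨d, hd⟩ := hPs P hP
  exact thetaEval_eq_zero_of_mem_zeroSet L κM M e hΘ hd (fun x hx => hYX hx P hP) hw

/-- **For a split datum, `Z(𝔍(Lie G')) ⊆ Lie G' + ker`.** [folklore] -/
theorem zeroSet_vanishing_tangent_subset_of_split (K : SubgroupDataC β γ δ κM) (S : Finset γ)
    (hC : K.C = coordSpan S) :
    M.zeroSet ((M.vanishing (K.tangent : Set (β ⊕ (γ ⊕ δ) → ℂ)) : Ideal _) :
        Set (MvPolynomial (Fin (N + 1)) ℂ)) ⊆ preimageSubgroup L κM K :=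
  zeroSet_vanishing_subset_of_thetaDefinable L κM M e hΘ (thetaDefinable_preimageSubgroup_of_split L κM K S hC)
    fun _ hw => AddSubgroup.mem_sup_left hw

end Model

end Std

end GaGmE

end Literature.NumberTheory.Transcendental

end
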